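import Literature.NumberTheory.LFunctions.NoRealZeroUpTo
import Literature.NumberTheory.LFunctions.SiegelAbelSummation
import HarnessLib

/-!
# Positivity form of the no-real-zero criteria: a table certifying `L(σ, χ) > 0` IS a table
# certifying `L(σ, χ) ≠ 0`, and conversely

Topic `Literature/NumberTheory/LFunctions`; namespace `Literature.NumberTheory.LFunctions`.
Everything here is PROVED (theorems only; no definition, no named fact).

The certified tables of the no-exceptional-zero column come as POSITIVITY statements: a lineage-A
row certifies `Λ_d(σ) = (|d|/π)^{(σ+a)/2} Γ((σ+a)/2) L(σ, χ_d) > 0` on `[0, 1]`, i.e. `L(σ, χ_d) > 0`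
on `(0, 1)`; the criteria `NoRealZeroUpTo Q` / `NoExceptionalZeroUpTo Q c₀` (`NoRealZeroUpTo.lean`,
`NoExceptionalZeroUpTo.lean`) are NON-VANISHING statements. For a real character the two are the
same thing, because `L(σ, χ)` is real and continuous on `(0, ∞)`, positive for `σ ≥ 1`
(`L(1, χ) > 0`), so by the intermediate value theorem it is positive on any zero-free interval
reaching `1` (tree: `DirichletAbel.LFunction_ofReal_re_pos_of_forall_ne_zero`, Montgomery–Vaughan
p. 102). This file records both directions:

* `NoExceptionalZeroUpTo.lfunction_re_pos` — a NARROW table gives `L(σ, χ) > 0` (and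
  `Im L(σ, χ) = 0`) on its window `[1 − c₀/log q, 1] ∩ (0, 1]`, for every quadratic `χ ≠ χ₀` mod
  `q ≤ Q` (imprimitive included);
* `NoRealZeroUpTo.lfunction_re_pos` — a WIDE table gives `L(σ, χ) > 0` for all `σ > 0`; in
  particular `NoRealZeroUpTo.lfunction_one_half_pos`: the central values `L(1/2, χ) > 0`
  (Chowla's non-vanishing, in the range);
* `noRealZeroUpTo_of_re_pos`, `noExceptionalZeroUpTo_of_re_pos` — conversely, positivity rows for
  the primitive quadratic characters of moduli `3 ≤ q ≤ Q` give the criteria (trivial direction;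
  this is the form in which a certificate `Λ_d > 0` is consumed).

## References

* H. L. Montgomery, R. C. Vaughan, *Multiplicative Number Theory I*, CUP 2007, §4.3 (p. 102:
  `L(σ, χ) > 0` for `σ > 0` "if `L(s, χ)` has no real zeros") and §11.2. [MontgomeryVaughan2007]
* D. J. Platt, Math. Comp. 85 (2016) 3009–3027, Theorem 7.2 (`L(1/2, χ) ≠ 0`, `q ≤ 2·10⁶`).
  [Platt2016GRH]
-/

noncomputable section

open Complex Literature.Barriers.Parity

namespace Literature.NumberTheory.LFunctions

open DirichletAbel

variable {Q : ℕ}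

/-! ### Non-vanishing tables are positivity tables -/

namespace NoExceptionalZeroUpTo

/-- **Positivity on the window from a narrow table.** Under `NoExceptionalZeroUpTo Q c₀`: for every
quadratic `χ ≠ χ₀` mod `q ≤ Q` and every real `σ` with `0 < σ ≤ 1`, `1 − c₀/log q ≤ σ`:
`Re L(σ, χ) > 0` (no zero on `[σ, 1]` by `lfunction_ne_zero`; `L` real, continuous, `L(1, χ) > 0`;
intermediate value theorem). [cite: MontgomeryVaughan2007, §4.3 p. 102] -/
theorem lfunction_re_pos {c₀ : ℝ} (h : NoExceptionalZeroUpTo Q c₀) {q : ℕ} [NeZero q] (hqQ : q ≤ Q)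
    (χ : DirichletCharacter ℂ q) (hquad : χ.IsQuadratic) (hχ : χ ≠ 1) {σ : ℝ} (hσ0 : 0 < σ)
    (hσ : 1 - c₀ / Real.log q ≤ σ) (hσ1 : σ ≤ 1) : 0 < (χ.LFunction σ).re :=
  LFunction_ofReal_re_pos_of_forall_ne_zero χ hχ (MulChar.isQuadratic_iff_sq_eq_one.mp hquad) hσ0 hσ1
    fun _ h1 _ ↦ h.lfunction_ne_zero hqQ χ hquad hχ (hσ0.trans_le h1) (hσ.trans h1)

/-- On the window of a narrow table `L(σ, χ)` is a positive REAL number: `Im L(σ, χ) = 0` and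
`Re L(σ, χ) > 0`. [cite: MontgomeryVaughan2007, §4.3 p. 102] -/
theorem lfunction_im_eq_zero_and_re_pos {c₀ : ℝ} (h : NoExceptionalZeroUpTo Q c₀) {q : ℕ} [NeZero q]
    (hqQ : q ≤ Q) (χ : DirichletCharacter ℂ q) (hquad : χ.IsQuadratic) (hχ : χ ≠ 1) {σ : ℝ}
    (hσ0 : 0 < σ) (hσ : 1 - c₀ / Real.log q ≤ σ) (hσ1 : σ ≤ 1) :
    (χ.LFunction σ).im = 0 ∧ 0 < (χ.LFunction σ).re :=
  ⟨LFunction_ofReal_im_eq_zero χ hχ (MulChar.isQuadratic_iff_sq_eq_one.mp hquad) hσ0,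
    h.lfunction_re_pos hqQ χ hquad hχ hσ0 hσ hσ1⟩

end NoExceptionalZeroUpTo

namespace NoRealZeroUpTo

/-- **Positivity on `(0, ∞)` from a wide table.** Under `NoRealZeroUpTo Q`: for every quadratic
`χ ≠ χ₀` mod `q ≤ Q` and every real `σ > 0`, `Re L(σ, χ) > 0` (for `σ ≤ 1` by the intermediate
value theorem from `L(1, χ) > 0`; for `σ > 1` directly). [cite: MontgomeryVaughan2007, §4.3 p. 102] -/
theorem lfunction_re_pos (h : NoRealZeroUpTo Q) {q : ℕ} [NeZero q] (hqQ : q ≤ Q)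
    (χ : DirichletCharacter ℂ q) (hquad : χ.IsQuadratic) (hχ : χ ≠ 1) {σ : ℝ} (hσ0 : 0 < σ) :
    0 < (χ.LFunction σ).re := by
  have hsq : χ ^ 2 = 1 := MulChar.isQuadratic_iff_sq_eq_one.mp hquad
  rcases le_or_gt σ 1 with h1 | h1
  · exact LFunction_ofReal_re_pos_of_forall_ne_zero χ hχ hsq hσ0 h1
      fun _ h1' _ ↦ h.lfunction_ne_zero hqQ χ hquad hχ (hσ0.trans_le h1')
  · exact LFunction_ofReal_re_pos_of_one_lt χ hsq h1

/-- Under a wide table `L(σ, χ)` is a positive REAL number for every `σ > 0`.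
[cite: MontgomeryVaughan2007, §4.3 p. 102] -/
theorem lfunction_im_eq_zero_and_re_pos (h : NoRealZeroUpTo Q) {q : ℕ} [NeZero q] (hqQ : q ≤ Q)
    (χ : DirichletCharacter ℂ q) (hquad : χ.IsQuadratic) (hχ : χ ≠ 1) {σ : ℝ} (hσ0 : 0 < σ) :
    (χ.LFunction σ).im = 0 ∧ 0 < (χ.LFunction σ).re :=
  ⟨LFunction_ofReal_im_eq_zero χ hχ (MulChar.isQuadratic_iff_sq_eq_one.mp hquad) hσ0,
    h.lfunction_re_pos hqQ χ hquad hχ hσ0⟩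

/-- **Central values from a wide table**: under `NoRealZeroUpTo Q`, `L(1/2, χ) > 0` for every
quadratic `χ ≠ χ₀` mod `q ≤ Q` (Chowla's central non-vanishing in the certified range; Platt's
Theorem 7.2 asserts `L(1/2, χ) ≠ 0` for primitive `χ`, `q ≤ 2·10⁶`). [cite: Platt2016GRH, Theorem 7.2] -/
theorem lfunction_one_half_pos (h : NoRealZeroUpTo Q) {q : ℕ} [NeZero q] (hqQ : q ≤ Q)
    (χ : DirichletCharacter ℂ q) (hquad : χ.IsQuadratic) (hχ : χ ≠ 1) :
    0 < (χ.LFunction (1 / 2 : ℝ)).re :=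
  h.lfunction_re_pos hqQ χ hquad hχ (by norm_num)

end NoRealZeroUpTo

/-! ### Positivity tables are non-vanishing tables -/

/-- **A wide positivity table is a wide table**: if `Re L(σ, χ) > 0` for every modulus `3 ≤ q ≤ Q`,
every primitive quadratic `χ` mod `q` and every `σ ∈ (0, 1)`, then `NoRealZeroUpTo Q`.
[cite: MontgomeryVaughan2007, §4.3 p. 102] -/
theorem noRealZeroUpTo_of_re_pos
    (h : ∀ (q : ℕ) [NeZero q], 3 ≤ q → q ≤ Q → ∀ χ : DirichletCharacter ℂ q, χ.IsQuadratic →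
      χ.IsPrimitive → ∀ σ : ℝ, 0 < σ → σ < 1 → 0 < (χ.LFunction σ).re) :
    NoRealZeroUpTo Q := by
  intro q _ hq3 hqQ χ hquad hprim σ hσ0 hσ1 h0
  have := h q hq3 hqQ χ hquad hprim σ hσ0 hσ1
  rw [h0, Complex.zero_re] at this
  exact lt_irrefl _ this

/-- **A narrow positivity table is a narrow table**: if `Re L(σ, χ) > 0` for every modulus
`3 ≤ q ≤ Q`, every primitive quadratic `χ` mod `q` and every `σ ∈ (0, 1)` with `1 − c₀/log q ≤ σ`,
then `NoExceptionalZeroUpTo Q c₀` (at `σ = 1`, `L(1, χ) ≠ 0`). [cite: MontgomeryVaughan2007, §4.3 p. 102] -/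
theorem noExceptionalZeroUpTo_of_re_pos {c₀ : ℝ}
    (h : ∀ (q : ℕ) [NeZero q], 3 ≤ q → q ≤ Q → ∀ χ : DirichletCharacter ℂ q, χ.IsQuadratic →
      χ.IsPrimitive → ∀ σ : ℝ, 0 < σ → 1 - c₀ / Real.log q ≤ σ → σ < 1 → 0 < (χ.LFunction σ).re) :
    NoExceptionalZeroUpTo Q c₀ := by
  intro q _ hq3 hqQ χ hquad hprim σ hσ0 hσ hσ1 h0
  have hne : χ ≠ 1 := SiegelZeroQuality.ne_one_of_isPrimitive hprim (by omega)
  rcases eq_or_lt_of_le hσ1 with rfl | hlt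
  · exact DirichletCharacter.LFunction_ne_zero_of_one_le_re χ (Or.inl hne) (by simp) h0
  · have := h q hq3 hqQ χ hquad hprim σ hσ0 hσ hlt
    rw [h0, Complex.zero_re] at this
    exact lt_irrefl _ this

/-- **Equivalence, wide form**: `NoRealZeroUpTo Q` holds iff `Re L(σ, χ) > 0` for all primitive
quadratic `χ` mod `3 ≤ q ≤ Q` and all `σ ∈ (0, 1)`. [cite: MontgomeryVaughan2007, §4.3 p. 102] -/
theorem noRealZeroUpTo_iff_re_pos :
    NoRealZeroUpTo Q ↔
      ∀ (q : ℕ) [NeZero q], 3 ≤ q → q ≤ Q → ∀ χ : DirichletCharacter ℂ q, χ.IsQuadratic →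
        χ.IsPrimitive → ∀ σ : ℝ, 0 < σ → σ < 1 → 0 < (χ.LFunction σ).re := by
  refine ⟨fun h q _ hq3 hqQ χ hquad hprim σ hσ0 _ ↦ ?_, noRealZeroUpTo_of_re_pos⟩
  exact h.lfunction_re_pos hqQ χ hquad (SiegelZeroQuality.ne_one_of_isPrimitive hprim (by omega)) hσ0

/-! ### The parity-split criteria (appended 2026-08-26; D-0070 SIEGEL INSTRUMENT)

The certified tables of the cell `parity-realchar` are booked PER PARITY (`NoRealZeroOddUpTo Q`,
`NoRealZeroEvenUpTo Q` of `NoRealZeroUpTo.lean`; the odd rung reaches `3·10¹⁰` while the even one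
stands at `10¹⁰`), so the positivity reading is recorded per parity as well: an ODD (resp. EVEN)
wide table gives `L(σ, χ) > 0` for every `σ > 0` and every PRIMITIVE quadratic odd (resp. even)
character of modulus `3 ≤ q ≤ Q` — in particular the central values `L(1/2, χ) > 0` that the
near-miss register of the cell lists (all its record rows are odd, `d < 0`). Same proof as the
wide case (`LFunction_ofReal_re_pos_of_forall_ne_zero`: real, continuous, positive at `σ ≥ 1`,
intermediate value theorem); stated for primitive characters only (the parity-split criteria
quantify over primitive characters; no change of level is needed). -/

namespace NoRealZeroOddUpTo

/-- **Positivity on `(0, ∞)` from an ODD wide table.** Under `NoRealZeroOddUpTo Q`: for every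
modulus `3 ≤ q ≤ Q`, every primitive quadratic ODD `χ` mod `q` and every real `σ > 0`,
`Re L(σ, χ) > 0`. [cite: MontgomeryVaughan2007, §4.3 p. 102] -/
theorem lfunction_re_pos (h : NoRealZeroOddUpTo Q) {q : ℕ} [NeZero q] (hq3 : 3 ≤ q) (hqQ : q ≤ Q)
    (χ : DirichletCharacter ℂ q) (hquad : χ.IsQuadratic) (hprim : χ.IsPrimitive) (hodd : χ.Odd)
    {σ : ℝ} (hσ0 : 0 < σ) : 0 < (χ.LFunction σ).re := by
  have hne : χ ≠ 1 := SiegelZeroQuality.ne_one_of_isPrimitive hprim (by omega)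
  have hsq : χ ^ 2 = 1 := MulChar.isQuadratic_iff_sq_eq_one.mp hquad
  rcases le_or_gt σ 1 with h1 | h1
  · refine LFunction_ofReal_re_pos_of_forall_ne_zero χ hne hsq hσ0 h1 fun σ' hσ' hσ'1 ↦ ?_
    rcases eq_or_lt_of_le hσ'1 with rfl | hlt
    · exact DirichletCharacter.LFunction_ne_zero_of_one_le_re χ (Or.inl hne) (by simp)
    · exact h q hq3 hqQ χ hquad hprim hodd σ' (hσ0.trans_le hσ') hlt
  · exact LFunction_ofReal_re_pos_of_one_lt χ hsq h1

/-- Under an odd wide table `L(σ, χ)` is a positive REAL number for every `σ > 0` (primitive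
quadratic odd `χ`, `3 ≤ q ≤ Q`). [cite: MontgomeryVaughan2007, §4.3 p. 102] -/
theorem lfunction_im_eq_zero_and_re_pos (h : NoRealZeroOddUpTo Q) {q : ℕ} [NeZero q] (hq3 : 3 ≤ q)
    (hqQ : q ≤ Q) (χ : DirichletCharacter ℂ q) (hquad : χ.IsQuadratic) (hprim : χ.IsPrimitive)
    (hodd : χ.Odd) {σ : ℝ} (hσ0 : 0 < σ) : (χ.LFunction σ).im = 0 ∧ 0 < (χ.LFunction σ).re :=
  ⟨LFunction_ofReal_im_eq_zero χ (SiegelZeroQuality.ne_one_of_isPrimitive hprim (by omega))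
      (MulChar.isQuadratic_iff_sq_eq_one.mp hquad) hσ0,
    h.lfunction_re_pos hq3 hqQ χ hquad hprim hodd hσ0⟩

/-- **Central values from an odd wide table**: under `NoRealZeroOddUpTo Q`, `L(1/2, χ) > 0` for
every primitive quadratic odd `χ` mod `3 ≤ q ≤ Q` (the statement behind the cell's near-miss
register of smallest central values `L(1/2, χ_d)`, `d < 0`). [cite: Platt2016GRH, Theorem 7.2] -/
theorem lfunction_one_half_pos (h : NoRealZeroOddUpTo Q) {q : ℕ} [NeZero q] (hq3 : 3 ≤ q)
    (hqQ : q ≤ Q) (χ : DirichletCharacter ℂ q) (hquad : χ.IsQuadratic) (hprim : χ.IsPrimitive)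
    (hodd : χ.Odd) : 0 < (χ.LFunction (1 / 2 : ℝ)).re :=
  h.lfunction_re_pos hq3 hqQ χ hquad hprim hodd (by norm_num)

end NoRealZeroOddUpTo

namespace NoRealZeroEvenUpTo

/-- **Positivity on `(0, ∞)` from an EVEN wide table.** Under `NoRealZeroEvenUpTo Q`: for every
modulus `3 ≤ q ≤ Q`, every primitive quadratic EVEN `χ` mod `q` and every real `σ > 0`,
`Re L(σ, χ) > 0`. [cite: MontgomeryVaughan2007, §4.3 p. 102] -/
theorem lfunction_re_pos (h : NoRealZeroEvenUpTo Q) {q : ℕ} [NeZero q] (hq3 : 3 ≤ q) (hqQ : q ≤ Q)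
    (χ : DirichletCharacter ℂ q) (hquad : χ.IsQuadratic) (hprim : χ.IsPrimitive) (hev : χ.Even)
    {σ : ℝ} (hσ0 : 0 < σ) : 0 < (χ.LFunction σ).re := by
  have hne : χ ≠ 1 := SiegelZeroQuality.ne_one_of_isPrimitive hprim (by omega)
  have hsq : χ ^ 2 = 1 := MulChar.isQuadratic_iff_sq_eq_one.mp hquad
  rcases le_or_gt σ 1 with h1 | h1
  · refine LFunction_ofReal_re_pos_of_forall_ne_zero χ hne hsq hσ0 h1 fun σ' hσ' hσ'1 ↦ ?_
    rcases eq_or_lt_of_le hσ'1 with rfl | hlt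
    · exact DirichletCharacter.LFunction_ne_zero_of_one_le_re χ (Or.inl hne) (by simp)
    · exact h q hq3 hqQ χ hquad hprim hev σ' (hσ0.trans_le hσ') hlt
  · exact LFunction_ofReal_re_pos_of_one_lt χ hsq h1

/-- **Central values from an even wide table**: under `NoRealZeroEvenUpTo Q`, `L(1/2, χ) > 0` for
every primitive quadratic even `χ` mod `3 ≤ q ≤ Q`. [cite: Platt2016GRH, Theorem 7.2] -/
theorem lfunction_one_half_pos (h : NoRealZeroEvenUpTo Q) {q : ℕ} [NeZero q] (hq3 : 3 ≤ q)
    (hqQ : q ≤ Q) (χ : DirichletCharacter ℂ q) (hquad : χ.IsQuadratic) (hprim : χ.IsPrimitive)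
    (hev : χ.Even) : 0 < (χ.LFunction (1 / 2 : ℝ)).re :=
  h.lfunction_re_pos hq3 hqQ χ hquad hprim hev (by norm_num)

end NoRealZeroEvenUpTo

/-- **An odd positivity table is an odd wide table**: if `Re L(σ, χ) > 0` for every modulus
`3 ≤ q ≤ Q`, every primitive quadratic odd `χ` mod `q` and every `σ ∈ (0, 1)`, then
`NoRealZeroOddUpTo Q` (the form in which a certificate `Λ_d(σ) > 0`, `d < 0`, is consumed).
[cite: MontgomeryVaughan2007, §4.3 p. 102] -/
theorem noRealZeroOddUpTo_of_re_pos
    (h : ∀ (q : ℕ) [NeZero q], 3 ≤ q → q ≤ Q → ∀ χ : DirichletCharacter ℂ q, χ.IsQuadratic →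
      χ.IsPrimitive → χ.Odd → ∀ σ : ℝ, 0 < σ → σ < 1 → 0 < (χ.LFunction σ).re) :
    NoRealZeroOddUpTo Q := by
  intro q _ hq3 hqQ χ hquad hprim hodd σ hσ0 hσ1 h0
  have := h q hq3 hqQ χ hquad hprim hodd σ hσ0 hσ1
  rw [h0, Complex.zero_re] at this
  exact lt_irrefl _ this

/-- **An even positivity table is an even wide table** (`d > 0`). [cite: MontgomeryVaughan2007, §4.3 p. 102] -/
theorem noRealZeroEvenUpTo_of_re_pos
    (h : ∀ (q : ℕ) [NeZero q], 3 ≤ q → q ≤ Q → ∀ χ : DirichletCharacter ℂ q, χ.IsQuadratic →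
      χ.IsPrimitive → χ.Even → ∀ σ : ℝ, 0 < σ → σ < 1 → 0 < (χ.LFunction σ).re) :
    NoRealZeroEvenUpTo Q := by
  intro q _ hq3 hqQ χ hquad hprim hev σ hσ0 hσ1 h0
  have := h q hq3 hqQ χ hquad hprim hev σ hσ0 hσ1
  rw [h0, Complex.zero_re] at this
  exact lt_irrefl _ this

/-- **Equivalence, odd form**: `NoRealZeroOddUpTo Q` holds iff `Re L(σ, χ) > 0` for all primitive
quadratic odd `χ` mod `3 ≤ q ≤ Q` and all `σ ∈ (0, 1)`. [cite: MontgomeryVaughan2007, §4.3 p. 102] -/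
theorem noRealZeroOddUpTo_iff_re_pos :
    NoRealZeroOddUpTo Q ↔
      ∀ (q : ℕ) [NeZero q], 3 ≤ q → q ≤ Q → ∀ χ : DirichletCharacter ℂ q, χ.IsQuadratic →
        χ.IsPrimitive → χ.Odd → ∀ σ : ℝ, 0 < σ → σ < 1 → 0 < (χ.LFunction σ).re :=
  ⟨fun h _ _ hq3 hqQ χ hquad hprim hodd _ hσ0 _ ↦ h.lfunction_re_pos hq3 hqQ χ hquad hprim hodd hσ0,
    noRealZeroOddUpTo_of_re_pos⟩

/-- **Equivalence, even form**: `NoRealZeroEvenUpTo Q` holds iff `Re L(σ, χ) > 0` for all primitive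
quadratic even `χ` mod `3 ≤ q ≤ Q` and all `σ ∈ (0, 1)`. [cite: MontgomeryVaughan2007, §4.3 p. 102] -/
theorem noRealZeroEvenUpTo_iff_re_pos :
    NoRealZeroEvenUpTo Q ↔
      ∀ (q : ℕ) [NeZero q], 3 ≤ q → q ≤ Q → ∀ χ : DirichletCharacter ℂ q, χ.IsQuadratic →
        χ.IsPrimitive → χ.Even → ∀ σ : ℝ, 0 < σ → σ < 1 → 0 < (χ.LFunction σ).re :=
  ⟨fun h _ _ hq3 hqQ χ hquad hprim hev _ hσ0 _ ↦ h.lfunction_re_pos hq3 hqQ χ hquad hprim hev hσ0,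
    noRealZeroEvenUpTo_of_re_pos⟩

/-! ### All odd / even quadratic characters, imprimitive ones included (appended 2026-08-26)

The parity-split criteria quantify over PRIMITIVE characters; an imprimitive quadratic `χ ≠ χ₀`
mod `q` is induced from its primitive character `χ⋆` of conductor `q⋆ ∣ q`, which is quadratic,
has `3 ≤ q⋆ ≤ q`, the SAME PARITY (`χ(−1) = χ⋆(−1)`, `−1` being a unit), and
`L(σ, χ) = L(σ, χ⋆) ∏_{p ∣ q} (1 − χ⋆(p) p^{−σ})` with non-zero factors (Mathlib
`LFunction_changeLevel`; Montgomery–Vaughan (10.20)) — the level-change argument of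
`NoExceptionalZeroUpTo.lfunction_ne_zero`, run inside one parity class. -/

/-- The primitive character inducing `χ` has the same value at `−1`. [folklore] -/
private theorem primitiveCharacter_neg_one {q : ℕ} [NeZero q] (χ : DirichletCharacter ℂ q) :
    χ.primitiveCharacter (-1) = χ (-1) := by
  have h := DirichletCharacter.changeLevel_eq_cast_of_dvd' χ.primitiveCharacter χ.conductor_dvd_level
    (a := -1) (isCoprime_one_left.neg_left)
  rw [DirichletCharacter.changeLevel_primitiveCharacter] at h
  push_cast at h
  exact h.symm

/-- Level change inside a parity class: under a hypothesis on all PRIMITIVE quadratic characters of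
moduli `3 ≤ q' ≤ Q` with a given value `ε` at `−1`, every quadratic `χ ≠ χ₀` mod `q ≤ Q` with
`χ(−1) = ε` has `L(σ, χ) ≠ 0` on `(0, 1)`. [cite: MontgomeryVaughan2007, §10.1 (10.20) and Corollary 11.8] -/
private theorem lfunction_ne_zero_of_primitive {ε : ℂ}
    (h : ∀ (q : ℕ) [NeZero q], 3 ≤ q → q ≤ Q →
      ∀ χ : DirichletCharacter ℂ q, χ.IsQuadratic → χ.IsPrimitive → χ (-1) = ε →
        ∀ σ : ℝ, 0 < σ → σ < 1 → χ.LFunction σ ≠ 0)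
    {q : ℕ} [NeZero q] (hqQ : q ≤ Q) (χ : DirichletCharacter ℂ q) (hquad : χ.IsQuadratic)
    (hχ : χ ≠ 1) (hpar : χ (-1) = ε) {σ : ℝ} (hσ0 : 0 < σ) (hσ1 : σ < 1) : χ.LFunction σ ≠ 0 := by
  haveI : NeZero χ.conductor := ⟨χ.conductor_ne_zero⟩
  set ψ := χ.primitiveCharacter with hψdef
  have hχψ : DirichletCharacter.changeLevel χ.conductor_dvd_level ψ = χ :=
    DirichletCharacter.changeLevel_primitiveCharacter χ
  have hψ1 : ψ ≠ 1 := fun h' => hχ (by rw [← hχψ, h', map_one])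
  have hsq : χ ^ 2 = 1 := MulChar.isQuadratic_iff_sq_eq_one.mp hquad
  have hψsq : ψ ^ 2 = 1 :=
    DirichletCharacter.changeLevel_injective χ.conductor_dvd_level
      (by rw [map_pow, hχψ, hsq, map_one])
  have hψquad : ψ.IsQuadratic := MulChar.isQuadratic_iff_sq_eq_one.mpr hψsq
  have hψprim : ψ.IsPrimitive := DirichletCharacter.primitiveCharacter_isPrimitive χ
  have hψpar : ψ (-1) = ε := by rw [hψdef, primitiveCharacter_neg_one χ]; exact hpar
  have hd3 : 3 ≤ χ.conductor := SiegelZeroPrimePairBarrierNarrow.three_le_level_of_ne_one ψ hψ1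
  have hdq : χ.conductor ≤ q := Nat.le_of_dvd (Nat.pos_of_ne_zero (NeZero.ne q)) χ.conductor_dvd_level
  intro hL
  have hLψ : ψ.LFunction σ = 0 := by
    have hfac := DirichletCharacter.LFunction_changeLevel χ.conductor_dvd_level ψ
      (s := (σ : ℂ)) (Or.inl hψ1)
    rw [hχψ] at hfac
    rw [hfac] at hL
    rcases mul_eq_zero.mp hL with h' | h'
    · exact h'
    · exact absurd h' (Finset.prod_ne_zero_iff.mpr fun p hp =>
        SiegelZeroPrimePairBarrierNarrow.one_sub_mul_cpow_ne_zero ψ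
          (Nat.prime_of_mem_primeFactors hp).two_le hσ0)
  exact h χ.conductor hd3 (hdq.trans hqQ) ψ hψquad hψprim hψpar σ hσ0 hσ1 hLψ

namespace NoRealZeroOddUpTo

/-- **An odd wide table controls every odd quadratic non-principal character up to level `Q`**
(imprimitive included): under `NoRealZeroOddUpTo Q`, for `q ≤ Q`, `χ ≠ χ₀` quadratic odd mod `q`,
and `0 < σ < 1`: `L(σ, χ) ≠ 0`. [cite: MontgomeryVaughan2007, §10.1 (10.20) and Corollary 11.8] -/
theorem lfunction_ne_zero (h : NoRealZeroOddUpTo Q) {q : ℕ} [NeZero q] (hqQ : q ≤ Q)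
    (χ : DirichletCharacter ℂ q) (hquad : χ.IsQuadratic) (hχ : χ ≠ 1) (hodd : χ.Odd) {σ : ℝ}
    (hσ0 : 0 < σ) (hσ1 : σ < 1) : χ.LFunction σ ≠ 0 :=
  lfunction_ne_zero_of_primitive (ε := -1)
    (fun q' _ hq3 hqQ' χ' hquad' hprim' hodd' σ' hσ0' hσ1' ↦ h q' hq3 hqQ' χ' hquad' hprim' hodd' σ' hσ0' hσ1')
    hqQ χ hquad hχ hodd hσ0 hσ1

/-- Positivity for every odd quadratic `χ ≠ χ₀` mod `q ≤ Q` (imprimitive included): under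
`NoRealZeroOddUpTo Q`, `Re L(σ, χ) > 0` for all `σ > 0`. [cite: MontgomeryVaughan2007, §4.3 p. 102] -/
theorem lfunction_re_pos' (h : NoRealZeroOddUpTo Q) {q : ℕ} [NeZero q] (hqQ : q ≤ Q)
    (χ : DirichletCharacter ℂ q) (hquad : χ.IsQuadratic) (hχ : χ ≠ 1) (hodd : χ.Odd) {σ : ℝ}
    (hσ0 : 0 < σ) : 0 < (χ.LFunction σ).re := by
  have hsq : χ ^ 2 = 1 := MulChar.isQuadratic_iff_sq_eq_one.mp hquad
  rcases le_or_gt σ 1 with h1 | h1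
  · refine LFunction_ofReal_re_pos_of_forall_ne_zero χ hχ hsq hσ0 h1 fun σ' hσ' hσ'1 ↦ ?_
    rcases eq_or_lt_of_le hσ'1 with rfl | hlt
    · exact DirichletCharacter.LFunction_ne_zero_of_one_le_re χ (Or.inl hχ) (by simp)
    · exact h.lfunction_ne_zero hqQ χ hquad hχ hodd (hσ0.trans_le hσ') hlt
  · exact LFunction_ofReal_re_pos_of_one_lt χ hsq h1

end NoRealZeroOddUpTo

namespace NoRealZeroEvenUpTo

/-- **An even wide table controls every even quadratic non-principal character up to level `Q`**
(imprimitive included). [cite: MontgomeryVaughan2007, §10.1 (10.20) and Corollary 11.8] -/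
theorem lfunction_ne_zero (h : NoRealZeroEvenUpTo Q) {q : ℕ} [NeZero q] (hqQ : q ≤ Q)
    (χ : DirichletCharacter ℂ q) (hquad : χ.IsQuadratic) (hχ : χ ≠ 1) (hev : χ.Even) {σ : ℝ}
    (hσ0 : 0 < σ) (hσ1 : σ < 1) : χ.LFunction σ ≠ 0 :=
  lfunction_ne_zero_of_primitive (ε := 1)
    (fun q' _ hq3 hqQ' χ' hquad' hprim' hev' σ' hσ0' hσ1' ↦ h q' hq3 hqQ' χ' hquad' hprim' hev' σ' hσ0' hσ1')
    hqQ χ hquad hχ hev hσ0 hσ1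

/-- Positivity for every even quadratic `χ ≠ χ₀` mod `q ≤ Q` (imprimitive included): under
`NoRealZeroEvenUpTo Q`, `Re L(σ, χ) > 0` for all `σ > 0`. [cite: MontgomeryVaughan2007, §4.3 p. 102] -/
theorem lfunction_re_pos' (h : NoRealZeroEvenUpTo Q) {q : ℕ} [NeZero q] (hqQ : q ≤ Q)
    (χ : DirichletCharacter ℂ q) (hquad : χ.IsQuadratic) (hχ : χ ≠ 1) (hev : χ.Even) {σ : ℝ}
    (hσ0 : 0 < σ) : 0 < (χ.LFunction σ).re := by
  have hsq : χ ^ 2 = 1 := MulChar.isQuadratic_iff_sq_eq_one.mp hquad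
  rcases le_or_gt σ 1 with h1 | h1
  · refine LFunction_ofReal_re_pos_of_forall_ne_zero χ hχ hsq hσ0 h1 fun σ' hσ' hσ'1 ↦ ?_
    rcases eq_or_lt_of_le hσ'1 with rfl | hlt
    · exact DirichletCharacter.LFunction_ne_zero_of_one_le_re χ (Or.inl hχ) (by simp)
    · exact h.lfunction_ne_zero hqQ χ hquad hχ hev (hσ0.trans_le hσ') hlt
  · exact LFunction_ofReal_re_pos_of_one_lt χ hsq h1

end NoRealZeroEvenUpTo

end Literature.NumberTheory.LFunctions

end
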